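/-
Copyright (c) 2026 the pub-hodgecm-mathlib formalisation cell (harness21).  Prover seat hodgecm-mathlib-LH4-p15 (g2), req620 Track A «(D-RAM) FOUR-FRAME» squad
(STAGE-1b, row (2) of the piece `f_{T₊}`, the (β₂) road (R-36) «PURE-CELL LEDGER»; β₂ sub-dealer LH4-p04 (g10) WORD #24 letter ‹TERM.letter.v2›, holder LH4-p15: the E-side
label read of the terminal cell at depth `g = 0`), 2026-09-05.
-/
import Summits.HodgeConjecture.HodgeConjecture.Theorems.F0P3cDyRamDiagonalCellAffineLabel      -- ★ p862875 (LH4-p19 (g2), K4): `v_fst_eq_of_fixed_coords`; brings ★ `refSkew_map_and_v`, ★ Lit Eisenstein frame, ★ ω-conductor toolkit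
import HarnessLib

/-!
# Crux `H413`, line LH4 «(D-RAM) FOUR-FRAME» — STAGE-1b, row (2), the (β₂) road (R-36), row (ROW-TERM)′: «THE LABEL OF A TERMINAL VERTEX IS AN AFFINE SIGN OF DEPTH ZERO» —
# ★ K4 `exists_affineLabel_of_coords` with the roles of the two coefficients SWAPPED: `s = T̂·(â + b̂V)` with `|b̂| = 1 ≥ |â|` (`g = 0`), so the affine value `α₁ + γ₁V` is a unit
# EXACTLY off one top digit; there `ω(f) = ω(T̂)·ω(α₁ + γ₁V)`, and `|â + b̂V| = 1 ↔ |α₁ + γ₁V| = 1`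

Cell `hodgecm-mathlib` (D-0151), FLOOR 0, crux item H413 = `stmt-HodgeConjecture-24833`, route of record `HCCMUnconditional`; squad F0∕P3c∕LH4; lane
`--supports stmt-HodgeConjecture-24833 --as helper` (count-neutral; pays NO tier-0 row).  THEOREMS ONLY (no `def`, no instance, no notation, no `sorry`, default heartbeats);
★-only imports; states NO law; (β₂) stays a HYPOTHESIS.  DATUM-FREE E-side algebra: one valued field `K` with the sheet datum `IsRamifiedQuadraticDatum σ ϖ d t`, `d` even; no
lattice, no line model.

WHY (β₂ WORD #24 ‹TERM.letter.v2›; this seat 00:41:53Z (T-b); the `hNX`∕`hψ`∕(hL₁)(hL₂) reads of LH4-p19's ★ p863833 `cellDiff_eq_zero_of_fibration_reads₃` on the terminal cell).  On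
the TERMINAL cell `j + b = jl` of the live row the ray scalar of a glued vertex is `e₀ = T̂·(â + b̂·V)` in LH4-p16's digit `V = (κ̂ − κ₀)∕ξ₀` (`jE e₀ = Tr_ρ(μκ̂)∕(t·N_ρκ̂·N_Θ(cc(α − ρα)))`,
`Tr_ρ(μ(κ₀ + Vξ₀)) = Tr_ρ(μκ₀) + V·(μ − ρμ)ξ₀`), with `T̂` a `σ`-fixed unit and — the terminal feature — the SLOPE `b̂ = π^{−b}(μ − ρμ)ξ₀` a UNIT while `|â| ≤ 1` (`|Tr_ρ(μκ₀)| ≤ |μ|`):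
depth `g = 0`, the mirror image of ★ K4's `|â| = 1`, `|b̂| = |ϖ|^{2g}`, `1 ≤ g`.  By ★ `…RowVertexRayDichotomy` the vertex is labelled iff `|e₀| = 1`, and then its census letter is
`valueSetMod σ ϖ m* (e′ • X₊)` with `|e₀ − e′t₊| ≤ |ϖ|^{m*}`; THIS FILE reads both facts off the digit: Eisenstein coordinates `â∕t₊ = α₁ + y₁ϖ`, `b̂∕t₊ = γ₁ + y₂ϖ` (`α₁, γ₁, y₁, y₂`
`σ`-fixed, `|γ₁| = 1` by ★ K4 §1, `|α₁|, |y₁|, |y₂| ≤ 1` by parity), so `(â + b̂V)∕t₊ = (α₁ + γ₁V) + (y₁ + y₂V)·ϖ` with the tail of valuation `< 1`: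
* `|â + b̂V| = 1 ↔ |α₁ + γ₁V| = 1` (★ `v_fixed_add_fixed_mul_eq_max`: no cancellation between the even and the odd part) — the `NX`-read (the `X`-members are the digits with
  `|α₁ + γ₁V| < 1`, ONE top-digit class since `|γ₁| = 1`);
* if `|α₁ + γ₁V| = 1` and `|T̂(â + b̂V) − f·t₊| ≤ |ϖ|^{m*}` for a fixed `f`, then `ω(f) = ω(T̂)·ω(α₁ + γ₁V)` (★ `normSign_eq_of_near` at `m* ≥ 2d − 1` + ★ `normSign_mul_of_fixed`) —
  the `ψ`-read.
* HEAD `exists_affineLabel_of_coords_depthZero` — both clauses under one pair `(α₁, γ₁)` depending on `â, b̂` only.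
WHAT IS NOT CLAIMED: the M-side identity `e₀ = T̂(â + b̂V)` and the reading `ω(T̂) = ω(−h_W)` on populated vertices (the instance's business), any count.
HONEST LABEL.  Count-neutral local algebra; nothing printed is asserted; no census law is stated; ‹TERM.v2› stays OPEN; `HC_CM` is proved only modulo the 7 printed citations (2 remaining
named inputs: hLiu418 = `stmt-HodgeConjecture-24832`, h413 = `stmt-HodgeConjecture-24833`) until rung 0 closes.
## References
* [Serre1979] J.-P. Serre, *Local Fields*, GTM 67 (1979): Ch. I §6 Prop. 18 (`𝒪_E = 𝒪_F[ϖ]`), Ch. V §3 Prop. 5, Cor. 3 pp. 84–86 (the conductor), Ch. XV §2.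
* [Rogawski1990] J. D. Rogawski, *Automorphic Representations of Unitary Groups in Three Variables*, Ann. of Math. Stud. 123 (1990): §4.9 Prop. 4.9.1 (b) p. 55, §12.2.
* [LanglandsShelstad1987] R. P. Langlands, D. Shelstad, *On the definition of transfer factors*, Math. Ann. 278 (1987): §1–§3 (κ-signs).
* [Kottwitz1986BaseChangeUnits] R. E. Kottwitz, *Base change for unit elements of Hecke algebras*, Compositio Math. 60 (1986): §1 pp. 240–241.
-/

set_option autoImplicit false

noncomputable section

namespace Summit.HodgeConjecture.HodgeConjecture.Cruxes.H413.F0P3cDyRamAffineLabelDepthZero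

open scoped Valued WithZero
open WithZero
open Literature.NumberTheory.Automorphic.UnitaryThreeFourFrame (IsRamifiedQuadraticDatum normSign)
open Literature.NumberTheory.LocalFields (exists_fixed_coords_of_map_ne v_fixed_add_fixed_mul_eq_max)
open Literature.NumberTheory.LocalFields.WildQuadraticDatum (v_varpi_pow even_log_v_of_fixed normSign_eq_of_near normSign_mul_of_fixed)
open Summit.HodgeConjecture.HodgeConjecture.Cruxes.H413.F0P3cDyRamFourFramePieces (mstarOfRecord)
open Summit.HodgeConjecture.HodgeConjecture.Cruxes.H413.F0P3cDyRamDiagonalCellCleanRegime (refSkew_map_and_v)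
open Summit.HodgeConjecture.HodgeConjecture.Cruxes.H413.F0P3cDyRamDiagonalCellAffineLabel (v_fst_eq_of_fixed_coords)

variable {K : Type} [Field K] [Valued K ℤᵐ⁰] {σ : K →+* K} {ϖ : K} {d t : ℕ}

/-- A `σ`-fixed `y` with `|y|·exp(−1) ≤ 1` is integral (fixed elements have even valuation, `exp(1)` is not one of them). [cite: Serre1979, Ch. I §6 Prop. 18] -/
theorem v_le_one_of_fixed_of_mul_exp_le (hD : IsRamifiedQuadraticDatum σ ϖ d t) {y : K} (hσy : σ y = y) (hy : Valued.v y * exp (-1 : ℤ) ≤ 1) : Valued.v y ≤ 1 := by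
  obtain ⟨-, -, -, hfix, -, -, -⟩ := hD
  by_cases hy0 : y = 0
  · rw [hy0, map_zero]; exact zero_le
  obtain ⟨n, hn⟩ := hfix y hσy hy0
  rw [hn, ← exp_add, ← exp_zero, exp_le_exp] at hy
  rw [hn, ← exp_zero, exp_le_exp]
  omega

/-- **HEAD — «THE LABEL OF A TERMINAL VERTEX IS AN AFFINE SIGN OF DEPTH ZERO».**  At a complete sheet datum `IsRamifiedQuadraticDatum σ ϖ d t` with finite residue field and `d` EVEN,
for `â, b̂` with `|â| ≤ 1`, `|b̂| = 1`, there are `σ`-FIXED `α₁, γ₁` with `|α₁| ≤ 1`, `|γ₁| = 1` (the leading Eisenstein coefficients of `â∕t₊`, `b̂∕t₊`, `t₊ = (ϖ − σϖ)((ϖσϖ)^{d∕2})⁻¹`)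
such that for every `σ`-fixed integer `V`: (i) `|â + b̂·V| = 1 ↔ |α₁ + γ₁V| = 1`; (ii) for every `σ`-fixed unit `T̂` and `σ`-fixed `f` with `|α₁ + γ₁V| = 1` and
`|T̂·(â + b̂·V) − f·t₊| ≤ |ϖ|^{m*}`: `ω(f) = ω(T̂)·ω(α₁ + γ₁V)`. [cite: Serre1979, Ch. I §6 Prop. 18] [cite: Serre1979, Ch. V §3 Cor. 3 pp. 84–86] [cite: Rogawski1990, §4.9 Prop. 4.9.1 (b) p. 55]
[cite: LanglandsShelstad1987, §1–§3] -/
theorem exists_affineLabel_of_coords_depthZero [CompleteSpace K] [Finite 𝓀[K]] (hD : IsRamifiedQuadraticDatum σ ϖ d t) (hd2 : d % 2 = 0)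
    {â bh : K} (hâ : Valued.v â ≤ 1) (hbh : Valued.v bh = 1) :
    ∃ α₁ γ₁ : K, σ α₁ = α₁ ∧ Valued.v α₁ ≤ 1 ∧ σ γ₁ = γ₁ ∧ Valued.v γ₁ = 1 ∧
      (∀ V : K, σ V = V → Valued.v V ≤ 1 → (Valued.v (â + bh * V) = 1 ↔ Valued.v (α₁ + γ₁ * V) = 1)) ∧
      ∀ (T V f : K), σ T = T → Valued.v T = 1 → σ V = V → Valued.v V ≤ 1 → σ f = f → Valued.v (α₁ + γ₁ * V) = 1 →
        Valued.v (T * (â + bh * V) - f * ((ϖ - σ ϖ) * ((ϖ * σ ϖ) ^ ((d - d % 2) / 2))⁻¹)) ≤ Valued.v ϖ ^ mstarOfRecord d →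
        normSign σ f = normSign σ T * normSign σ (α₁ + γ₁ * V) := by
  obtain ⟨hσt, hvt⟩ := refSkew_map_and_v hD hd2
  obtain ⟨hσσ, hvσ, hϖ, hfix, hdd, hd1, ht⟩ := hD
  have hD' : IsRamifiedQuadraticDatum σ ϖ d t := ⟨hσσ, hvσ, hϖ, hfix, hdd, hd1, ht⟩
  have hfix' : ∀ c : K, σ c = c → c ≠ 0 → Even (log (Valued.v c)) := fun c hc hc0 => even_log_v_of_fixed hfix c hc hc0
  have hvϖ0 : Valued.v ϖ ≠ 0 := by rw [hϖ]; exact exp_ne_zero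
  have hϖlt : Valued.v ϖ < 1 := by rw [hϖ, ← exp_zero, exp_lt_exp]; norm_num
  have hϖσ : σ ϖ ≠ ϖ := fun h => by
    have : Valued.v (ϖ - σ ϖ) = 0 := by rw [h, sub_self, map_zero]
    rw [hdd] at this; exact pow_ne_zero _ hvϖ0 this
  set tp : K := (ϖ - σ ϖ) * ((ϖ * σ ϖ) ^ ((d - d % 2) / 2))⁻¹ with htp
  have htp0 : tp ≠ 0 := fun h0 => by rw [h0, map_zero] at hvt; exact zero_ne_one hvt
  -- Eisenstein coordinates of `â/t₊` and `b̂/t₊`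
  obtain ⟨α₁, y₁, hα₁, hy₁, hα⟩ := exists_fixed_coords_of_map_ne hσσ hϖσ (â / tp)
  obtain ⟨γ₁, y₂, hγ₁, hy₂, hγ⟩ := exists_fixed_coords_of_map_ne hσσ hϖσ (bh / tp)
  have hγ1 : Valued.v γ₁ = 1 := by
    have h := v_fst_eq_of_fixed_coords hD' hγ₁ hy₂ (n := 0) (by rw [← hγ, map_div₀, hbh, hvt, div_one]; norm_num)
    rw [h]; norm_num
  -- the parity reading of the two decompositions: `|α₁|, |y₁|, |y₂| ≤ 1`
  have hmaxa : max (Valued.v α₁) (Valued.v y₁ * exp (-1 : ℤ)) ≤ 1 := by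
    rw [← v_fixed_add_fixed_mul_eq_max hfix' hϖ hα₁ hy₁, ← hα, map_div₀, hvt, div_one]; exact hâ
  have hmaxb : max (Valued.v γ₁) (Valued.v y₂ * exp (-1 : ℤ)) ≤ 1 := by
    rw [← v_fixed_add_fixed_mul_eq_max hfix' hϖ hγ₁ hy₂, ← hγ, map_div₀, hbh, hvt, div_one]
  have hα1 : Valued.v α₁ ≤ 1 := (le_max_left _ _).trans hmaxa
  have hy₁1 : Valued.v y₁ ≤ 1 := v_le_one_of_fixed_of_mul_exp_le hD' hy₁ ((le_max_right _ _).trans hmaxa)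
  have hy₂1 : Valued.v y₂ ≤ 1 := v_le_one_of_fixed_of_mul_exp_le hD' hy₂ ((le_max_right _ _).trans hmaxb)
  -- the decomposition of the affine value
  have hdec : ∀ V : K, (â + bh * V) / tp = (α₁ + γ₁ * V) + (y₁ + y₂ * V) * ϖ := fun V => by
    have e1 : â = (α₁ + y₁ * ϖ) * tp := by rw [← hα, div_mul_cancel₀ â htp0]
    have e2 : bh = (γ₁ + y₂ * ϖ) * tp := by rw [← hγ, div_mul_cancel₀ bh htp0]
    rw [e1, e2]; field_simp; ring
  -- the tail is small: `|y₁ + y₂V|·exp(−1) < 1`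
  have htail : ∀ V : K, Valued.v V ≤ 1 → Valued.v (y₁ + y₂ * V) * exp (-1 : ℤ) < 1 := fun V hV1 => by
    have h1 : Valued.v (y₁ + y₂ * V) ≤ 1 := (Valuation.map_add _ _ _).trans (max_le hy₁1 (by rw [Valuation.map_mul]; exact mul_le_one' hy₂1 hV1))
    calc Valued.v (y₁ + y₂ * V) * exp (-1 : ℤ) ≤ 1 * exp (-1 : ℤ) := mul_le_mul' h1 le_rfl
      _ < 1 := by rw [one_mul, ← exp_zero, exp_lt_exp]; norm_num
  refine ⟨α₁, γ₁, hα₁, hα1, hγ₁, hγ1, fun V hσV hV1 => ?_, fun T V f hσT hT1 hσV hV1 hσf hNX hsf => ?_⟩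
  · -- (i) `|â + b̂V| = 1 ↔ |α₁ + γ₁V| = 1`
    have hmax := v_fixed_add_fixed_mul_eq_max hfix' hϖ (a := α₁ + γ₁ * V) (b := y₁ + y₂ * V)
      (by rw [map_add, map_mul, hα₁, hγ₁, hσV]) (by rw [map_add, map_mul, hy₁, hy₂, hσV])
    have hval : Valued.v (â + bh * V) = max (Valued.v (α₁ + γ₁ * V)) (Valued.v (y₁ + y₂ * V) * exp (-1 : ℤ)) := by
      rw [← hmax, ← hdec V, map_div₀, hvt, div_one]
    rw [hval]
    constructor
    · intro h
      rcases le_total (Valued.v (y₁ + y₂ * V) * exp (-1 : ℤ)) (Valued.v (α₁ + γ₁ * V)) with hle | hle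
      · rwa [max_eq_left hle] at h
      · rw [max_eq_right hle] at h; exact absurd h (ne_of_lt (htail V hV1))
    · intro h
      rw [h]; exact max_eq_left (htail V hV1).le
  · -- (ii) the sign
    have hT0 : T ≠ 0 := fun h0 => by rw [h0, map_zero] at hT1; exact zero_ne_one hT1
    set f₀ : K := T * (α₁ + γ₁ * V) with hf₀
    set Y : K := T * (y₁ + y₂ * V) with hY
    have hσf₀ : σ f₀ = f₀ := by rw [hf₀, map_mul, map_add, map_mul, hσT, hα₁, hγ₁, hσV]
    have hσY : σ Y = Y := by rw [hY, map_mul, map_add, map_mul, hσT, hy₁, hy₂, hσV]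
    have hdecT : T * (â + bh * V) / tp = f₀ + Y * ϖ := by
      rw [mul_div_assoc, hdec V, hf₀, hY]; ring
    have hf₀1 : Valued.v f₀ = 1 := by rw [hf₀, Valuation.map_mul, hT1, one_mul, hNX]
    have hnear : Valued.v (f₀ - f) ≤ Valued.v ϖ ^ mstarOfRecord d := by
      have h1 : Valued.v (T * (â + bh * V) / tp - f) ≤ Valued.v ϖ ^ mstarOfRecord d := by
        have e : T * (â + bh * V) / tp - f = (T * (â + bh * V) - f * tp) / tp := by field_simp
        rw [e, map_div₀, hvt, div_one]; exact hsf
      rw [hdecT] at h1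
      have e2 : f₀ + Y * ϖ - f = (f₀ - f) + Y * ϖ := by ring
      rw [e2, v_fixed_add_fixed_mul_eq_max hfix' hϖ (by rw [map_sub, hσf₀, hσf]) hσY] at h1
      exact (le_max_left _ _).trans h1
    rw [normSign_eq_of_near hD' hσf₀ hσf hf₀1 (n := mstarOfRecord d) (by simp only [mstarOfRecord]; omega) hnear, hf₀]
    have hαV0 : α₁ + γ₁ * V ≠ 0 := fun h0 => by rw [h0, map_zero] at hNX; exact zero_ne_one hNX
    exact normSign_mul_of_fixed hD' hσT (by rw [map_add, map_mul, hα₁, hγ₁, hσV]) hT0 hαV0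

/-- **COROLLARY — the label predicates are TOP-DIGIT class functions**: for `σ`-fixed `α₁, γ₁` with `|γ₁| ≤ 1` and `σ`-fixed integers `V, V′` with `|V − V′| ≤ |ϖ|^n`, `n ≥ 2d − 1`:
`|α₁ + γ₁V| = 1 → ω(α₁ + γ₁V′) = ω(α₁ + γ₁V)` (★ `normSign_eq_of_near`). [cite: Serre1979, Ch. XV §2] -/
theorem normSign_affine_eq_of_near [CompleteSpace K] (hD : IsRamifiedQuadraticDatum σ ϖ d t) {α₁ γ₁ : K} (hσα : σ α₁ = α₁) (hσγ : σ γ₁ = γ₁) (hγ : Valued.v γ₁ ≤ 1)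
    {V V' : K} (hσV : σ V = V) (hσV' : σ V' = V') {n : ℕ} (hn : 2 * d - 1 ≤ n) (hnear : Valued.v (V - V') ≤ Valued.v ϖ ^ n) (hNX : Valued.v (α₁ + γ₁ * V) = 1) :
    normSign σ (α₁ + γ₁ * V') = normSign σ (α₁ + γ₁ * V) := by
  refine normSign_eq_of_near hD (by rw [map_add, map_mul, hσα, hσγ, hσV]) (by rw [map_add, map_mul, hσα, hσγ, hσV']) hNX hn ?_
  have e : α₁ + γ₁ * V - (α₁ + γ₁ * V') = γ₁ * (V - V') := by ring
  rw [e, Valuation.map_mul]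
  calc Valued.v γ₁ * Valued.v (V - V') ≤ 1 * Valued.v ϖ ^ n := mul_le_mul' hγ hnear
    _ = Valued.v ϖ ^ n := one_mul _

end Summit.HodgeConjecture.HodgeConjecture.Cruxes.H413.F0P3cDyRamAffineLabelDepthZero

end
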